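import Summits.CriticalPhenomena.CardyFormulaZ2.Theorems.CardyBoundaryCoulombGasHalfPlaneMarkDensityLawWiredIffThreeArc
import Summits.CriticalPhenomena.CardyFormulaZ2.Theorems.CardyBoundaryCoulombGasHalfPlaneMarkDensityLawThreeArcLimit
import Summits.CriticalPhenomena.CardyFormulaZ2.Theorems.CardyBoundaryCoulombGasHalfPlaneMarkDensityLawWiredOfJointLimit

/-!
# `HalfPlaneMarkDensityLaw` (crux stmt-CriticalPhenomena-5661), line `Sketch`, cycle 10 (`WiredDual`), lead c12-0:
# assembly — **stmt-9321 (`HalfPlaneWiredCardy`, target of route CardyTotalPositivity) ⟺ identification of the THREE-ARC limits**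

`HalfPlaneWiredCardy ⟺ ∀ θ G (joint subsequential limit), ∀ a < b < c, lim_{y→∞} G(a,b,c,y) = F((b−a)/(c−a))`
(`halfPlaneWiredCardy_iff_threeArc`: W1 `stub_wired_of_jointLimit` + T1 `stub_threeArc_limit` + precompactness).  Together with
`halfPlaneMarkDensityLaw_iff_shape` (cycle 7) this places the two statements on one scale: stmt-9321 identifies the three-arc
limits `G₃`, stmt-5661 the `x`-shape of `∂₄G` (and implies stmt-9321, `…WiredCardy`).
-/

noncomputable section

namespace Summit.CriticalPhenomena.CardyFormulaZ2.Cruxes.HalfPlaneMarkDensityLaw.SketchLine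

open Literature.Probability.Percolation Literature.Probability.LatticeModels
open MeasureTheory Filter Set
open scoped Topology
open Summit.CriticalPhenomena.CardyFormulaZ2.Theses.CardyBoundaryCoulombGas (HalfPlaneMarkDensityLaw)
open Summit.CriticalPhenomena.CardyFormulaZ2.Theorems.HalfPlaneMarkDensityLaw.Negative

namespace WiredDual

/-- **`HalfPlaneWiredCardy ⟺` the three-arc limits of every joint subsequential limit are `F((b−a)/(c−a))`.** [folklore] -/
theorem halfPlaneWiredCardy_iff_threeArc :
    (Summit.CriticalPhenomena.CardyFormulaZ2.Theses.CardyTotalPositivity.HalfPlaneWiredCardy ↔ ∀ θ : ℕ → ℕ, StrictMono θ → ∀ G : ℝ → ℝ → ℝ → ℝ → ℝ, (∀ a b c y : ℝ, a < b → b < c → c < y → Tendsto (fun n ↦ μ.real (openCrossing halfPlane (arcA a b (θ n)) (rowIcc ⌊c * (θ n : ℕ)⌋ ⌊y * (θ n : ℕ)⌋))) atTop (𝓝 (G a b c y))) → ∀ a b c : ℝ, a < b → b < c → Tendsto (fun y : ℝ ↦ G a b c y) atTop (𝓝 (Literature.Probability.RandomPlanarGeometry.cardyFunction ((b - a) / (c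 - a))))) :=
  halfPlaneWiredCardy_iff_threeArc_of stub_wired_of_jointLimit (stub_threeArc_limit_of stub_wired_of_jointLimit)

/-- **Crux 5 identifies the three-arc limits**: under `HalfPlaneMarkDensityLaw`, `lim_{y→∞} G(a,b,c,y) = F((b−a)/(c−a))` for every
joint subsequential limit (crux 5 ⟹ stmt-9321, `…WiredCardy`, then `halfPlaneWiredCardy_iff_threeArc`). [folklore] -/
theorem threeArc_of_halfPlaneMarkDensityLaw (h : HalfPlaneMarkDensityLaw) {θ : ℕ → ℕ} (hθ : StrictMono θ)
    {G : ℝ → ℝ → ℝ → ℝ → ℝ}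
    (hG : ∀ a b c y : ℝ, a < b → b < c → c < y →
      Tendsto (fun n ↦ μ.real (openCrossing halfPlane (arcA a b (θ n))
        (rowIcc ⌊c * (θ n : ℕ)⌋ ⌊y * (θ n : ℕ)⌋))) atTop (𝓝 (G a b c y)))
    {a b c : ℝ} (hab : a < b) (hbc : b < c) :
    Tendsto (fun y : ℝ ↦ G a b c y) atTop
      (𝓝 (Literature.Probability.RandomPlanarGeometry.cardyFunction ((b - a) / (c - a)))) :=
  (halfPlaneWiredCardy_iff_threeArc.1 (halfPlaneWiredCardy_of_halfPlaneMarkDensityLaw h)) θ hθ G hG a b c hab hbc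

end WiredDual

end Summit.CriticalPhenomena.CardyFormulaZ2.Cruxes.HalfPlaneMarkDensityLaw.SketchLine
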